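import Mathlib.Analysis.SpecialFunctions.Pow.Asymptotics
import Literature.Probability.Percolation.TriangleSusceptibilityDerivative
import Literature.Probability.Percolation.MeanFieldDelta
import Literature.Probability.Percolation.InfraredBoundTriangle
import Literature.Barriers.CriticalPhenomena.KozmaNachmiasLemma23
import Summits.CriticalPhenomena.PercolationContinuityZ3.Theorems.PercNearOneGluingNoHeavyQuantThetaModulusR4
import HarnessLib

/-!
# The high-dimensional rows of the lane's (T1)/(T2) table: kernel instances of `ThetaHolderNearCritical d 1 C`,
# `OneArmPolyDecayAtCritical d (1/2) C` in every triangle-condition dimension, and the conditional rows for `d ≥ 11` / `d > 6`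

builds on p205010 (kernel theorem, internal audit signed; external expert review pending).
Status sentence for p205010: "θ(p_c) = 0 on ℤ^d, all d ≥ 2 — kernel-verified (Lean 4/Mathlib, standard
axioms); internal adversarial audit SIGNED 2026-08-20 04:29Z; external expert review pending."

Seat `prim-quant-p4` gen 4 (METHOD = differential inequalities for `θ` near `p_c`), `--supports stmt-CriticalPhenomena-4575`;
pure proofs, no definitions, BOOKKEEPING ONLY: every input is a tree theorem of `Literature/Probability/Percolation`
(Hutchcroft's 2022 route to Aizenman–Newman's `γ = 1` and Barsky–Aizenman's `β = 1`, `δ = 2` under the triangle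
condition: `betaEqOneBoundedRatio_of_triangle`, `real_clusterSizeGe_criticalProb_le_of_gamma`,
`AizenmanNewman1984_gamma_eq_one_holds`) or a NAMED published fact taken as a hypothesis
(`FitznerVanDerHofstad2017_infraredBound` = Fitzner–van der Hofstad 2017 Thm. 1.1, the lace expansion for `d ≥ 11`;
`KozmaNachmias2011_thm2` = Kozma–Nachmias 2011 Thm. 2).  The point is to record, in the lane's typed vocabulary
(`Quant.ThetaHolderNearCritical`, `Quant.OneArmPolyDecayAtCritical`, `Quant.OneArmPolyDecay`, `Quant.OneArmRateAtCritical`,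
`Quant.ThetaModulusNearCritical`; STATEMENTS.md table A, whose entry reads "OPEN for `3 ≤ d ≤ 10`"), what the two ends
of the dimension axis look like in the kernel: `d = 2` is `PercNearOneGluingNoHeavyQuantZ2PolyDecay.lean` (gen 3), and here

* `thetaHolderNearCritical_one_of_triangle` — **`TriangleCondition d ⇒ ∃ C > 0, ThetaHolderNearCritical d 1 C`** (the SHARP
  (T2) row: exponent `1 = β`, two-sided by `theta_two_sided_linear_of_triangle` with the tree's mean-field lower bound
  `sub_criticalProb_le_theta`); `thetaModulusNearCritical_linear_of_triangle` (`ω(t) = C t`);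
* `oneArmPolyDecayAtCritical_half_of_triangle` — **`TriangleCondition d ⇒ ∃ C, OneArmPolyDecayAtCritical d (1/2) C`**
  (`π_{p_c}(n) ≤ P_{p_c}(|C(0)| ≥ n+1) ≤ C/√(n+1)`: the upper half of `δ = 2` read through `oneArmProb_le_real_clusterSizeGe`;
  the sharp exponent is `2`, Kozma–Nachmias 2011, see the last item); `oneArmPolyDecay_of_triangle`, `oneArmRateAtCritical_of_triangle`;
* `highDimRows_of_infraredBound` — the same two rows for every `d ≥ 11`, CONDITIONAL on the named fact
  `FitznerVanDerHofstad2017_infraredBound` (printed theorem; its computer-assisted NoBLE proof is not formalised);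
* `oneArmPolyDecayAtCritical_two_of_kozmaNachmias` — `OneArmPolyDecayAtCritical d 2 C` for `d > 6` under the two-point
  bounded-ratio hypothesis, CONDITIONAL on the named fact `KozmaNachmias2011_thm2` (the tree proves Lemma 2.3 and the
  deduction of Thm. 1 from Thm. 2: `KozmaNachmias2011_oneArmUpper_of_thm2`).

Honest reading: classical/printed results (Barsky–Aizenman 1991, Hara–Slade, Fitzner–van der Hofstad 2017, Kozma–Nachmias
2011; Hutchcroft 2022 for the tree's route), no new mathematics; the value is that the lane's (T1)/(T2) predicates now have
kernel inhabitants at `d = 2` and in every triangle-condition dimension, with the honest gap `3 ≤ d ≤ 10` (where only the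
iterated-logarithm-type `OneArmRateAtCritical` / `ThetaModulusNearCritical` instances of the lane exist) stated by
exclusion.  The `d = 3` class of the lane's results is unchanged.

## References
* D. J. Barsky, M. Aizenman, *Percolation critical exponents under the triangle condition*, Ann. Probab. 19 (1991) 1520–1536.
* T. Hutchcroft, *On the derivation of mean-field percolation critical exponents from the triangle condition*,
  J. Stat. Phys. 189 (2022) no. 6 [Hutchcroft2022Triangle].
* R. Fitzner, R. van der Hofstad, *Mean-field behavior for nearest-neighbor percolation in d > 10*, Electron. J. Probab. 22
  (2017) no. 43, Thm. 1.1, Cor. 1.3 [FitznerVanDerHofstad2017].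
* G. Kozma, A. Nachmias, *Arm exponents in high dimensional percolation*, J. Amer. Math. Soc. 24 (2011) 375–409, Thms. 1–2
  [KozmaNachmias2011].
* M. Heydenreich, R. van der Hofstad, *Progress in High-Dimensional Percolation and Random Graphs*, Springer 2017, Thm. 4.1,
  Thm. 11.5 [HeydenreichVanDerHofstad2017].
-/

noncomputable section

namespace Summit.CriticalPhenomena.PercolationContinuityZ3.Theorems.Quant

open MeasureTheory Set Filter Topology Literature.Probability.Percolation Literature.Probability.LatticeModels
open Literature.Barriers.CriticalPhenomena

variable {d : ℕ}

/-! ### (T2) in triangle-condition dimensions: Hölder exponent `1`, two-sided -/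

/-- **(T2) row, triangle-condition dimensions: `TriangleCondition d ⇒ ∃ C > 0, ThetaHolderNearCritical d 1 C`** —
`θ(p) ≤ C (p − p_c)` for all `p ≥ p_c` (Barsky–Aizenman 1991; here the tree's `betaEqOneBoundedRatio_of_triangle`, proved
through Hutchcroft 2022).  Bookkeeping (the lane's vocabulary); exponent `1` is sharp (`theta_two_sided_linear_of_triangle`).
[cite: HeydenreichVanDerHofstad2017, Thm. 4.1] [cite: Hutchcroft2022Triangle, §1.1 (Thm. 1.3 and the deduction of (1.3))] -/
theorem thetaHolderNearCritical_one_of_triangle (hd : 2 ≤ d) (hT : TriangleCondition d) :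
    ∃ C : ℝ, 0 < C ∧ Quant.ThetaHolderNearCritical d 1 C := by
  obtain ⟨c₁, c₂, hc₁, hc₁₂, hb⟩ := betaEqOneBoundedRatio_of_triangle hd hT
  refine ⟨c₂, hc₁.trans hc₁₂, fun p hp => ?_⟩
  rw [Real.rpow_one]
  rw [coe_criticalProbI] at hp ⊢
  exact (hb p hp).2

/-- **Two-sided linear bounds in triangle-condition dimensions**: `p − p_c ≤ θ(p) ≤ C (p − p_c)` for all `p ≥ p_c`
(lower: the tree's Duminil-Copin–Tassion mean-field bound `sub_criticalProb_le_theta`, every `d ≥ 2`; upper: Barsky–Aizenman).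
Bookkeeping. [cite: DuminilCopinTassionEM2016, Thm. 1.1(2)] [cite: HeydenreichVanDerHofstad2017, Thm. 4.1] -/
theorem theta_two_sided_linear_of_triangle (hd : 2 ≤ d) (hT : TriangleCondition d) :
    ∃ C : ℝ, 0 < C ∧ ∀ p : unitInterval, (criticalProbI d : ℝ) ≤ p →
      (p : ℝ) - criticalProbI d ≤ theta (zdGraph d) 0 p ∧
        theta (zdGraph d) 0 p ≤ C * ((p : ℝ) - criticalProbI d) := by
  obtain ⟨c₁, c₂, hc₁, hc₁₂, hb⟩ := betaEqOneBoundedRatio_of_triangle hd hT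
  refine ⟨c₂, hc₁.trans hc₁₂, fun p hp => ⟨?_, ?_⟩⟩
  · rw [coe_criticalProbI] at hp ⊢
    exact sub_criticalProb_le_theta hd p hp
  · rw [coe_criticalProbI] at hp ⊢
    exact (hb p hp).2

/-- **(T2) row as a modulus**: `TriangleCondition d ⇒ ∃ C, ThetaModulusNearCritical d (t ↦ C t)` (a LINEAR modulus of
continuity of `θ` at `p_c⁺`).  Bookkeeping (`ThetaModulus.thetaModulusNearCritical_of_holder` at `b = 1`).
[cite: HeydenreichVanDerHofstad2017, Thm. 4.1] -/
theorem thetaModulusNearCritical_linear_of_triangle (hd : 2 ≤ d) (hT : TriangleCondition d) :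
    ∃ C : ℝ, Quant.ThetaModulusNearCritical d (fun t => C * t) := by
  obtain ⟨C, -, hH⟩ := thetaHolderNearCritical_one_of_triangle hd hT
  refine ⟨C, ?_⟩
  have h := ThetaModulus.thetaModulusNearCritical_of_holder one_pos hH
  simp only [Real.rpow_one] at h
  exact h

/-! ### (T1) in triangle-condition dimensions: one-arm exponent `1/2` from `δ = 2` -/

/-- **(T1) row, triangle-condition dimensions: `TriangleCondition d ⇒ ∃ C, OneArmPolyDecayAtCritical d (1/2) C`** —
`π_{p_c}(n) ≤ P_{p_c}(|C(0)| ≥ n+1) ≤ C/√(n+1) ≤ C n^{−1/2}` (`n ≥ 1`): the upper half of `δ = 2` under the triangle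
condition (tree: `real_clusterSizeGe_criticalProb_le_of_gamma` with `AizenmanNewman1984_gamma_eq_one_holds`, Hutchcroft's
route) read through `oneArmProb_le_real_clusterSizeGe` (a path to `∂Λ_n` has `n+1` vertices).  Exponent `1/2` is NOT sharp
(`2` is, Kozma–Nachmias 2011: `oneArmPolyDecayAtCritical_two_of_kozmaNachmias`, conditional).  Bookkeeping.
[cite: Hutchcroft2022Triangle, §1.1 (Thm. 1.3 and the sentence following it)] [cite: KozmaNachmias2011, proof of Lemma 2.3 (|C| ≥ r when 0 ↔ ∂Q_r)] -/
theorem oneArmPolyDecayAtCritical_half_of_triangle (hd : 2 ≤ d) (hT : TriangleCondition d) :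
    ∃ C : ℝ, Quant.OneArmPolyDecayAtCritical d (1 / 2) C := by
  obtain ⟨C, hC⟩ := real_clusterSizeGe_criticalProb_le_of_gamma AizenmanNewman1984_gamma_eq_one_holds hd hT
  have hC0 : 0 ≤ C := by
    have h1 := hC 1 le_rfl
    simp only [Nat.cast_one, Real.sqrt_one, div_one] at h1
    exact measureReal_nonneg.trans h1
  refine ⟨C, fun n hn => ?_⟩
  have hn0 : (0 : ℝ) < n := by exact_mod_cast hn
  calc (bondPercolation (zdGraph d) (criticalProbI d)).real (siteToBoundary d n)
      = oneArmProb d (criticalProbI d) n := rfl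
    _ ≤ (bondPercolation (zdGraph d) (criticalProbI d)).real (clusterSizeGe (0 : Site d) (n + 1)) :=
        oneArmProb_le_real_clusterSizeGe (by omega) _ n
    _ ≤ C / Real.sqrt ((n + 1 : ℕ) : ℝ) := hC (n + 1) (by omega)
    _ ≤ C / Real.sqrt n := by
        apply div_le_div_of_nonneg_left hC0 (Real.sqrt_pos.2 hn0)
        exact Real.sqrt_le_sqrt (by push_cast; linarith)
    _ = C * (n : ℝ) ^ (-(1 / 2 : ℝ)) := by
        rw [Real.sqrt_eq_rpow, Real.rpow_neg hn0.le, div_eq_mul_inv]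

/-- `TriangleCondition d ⇒ OneArmPolyDecay d` (existential (T1) row).  Bookkeeping.
[cite: Hutchcroft2022Triangle, §1.1 (Thm. 1.3)] -/
theorem oneArmPolyDecay_of_triangle (hd : 2 ≤ d) (hT : TriangleCondition d) : Quant.OneArmPolyDecay d := by
  obtain ⟨C, hC⟩ := oneArmPolyDecayAtCritical_half_of_triangle hd hT
  exact ⟨1 / 2, by norm_num, C, hC⟩

/-- `TriangleCondition d ⇒ OneArmRateAtCritical d (n ↦ C n^{−1/2})` (the effective `θ(p_c) = 0` row with a power rate).
Bookkeeping. [cite: Hutchcroft2022Triangle, §1.1 (Thm. 1.3)] -/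
theorem oneArmRateAtCritical_of_triangle (hd : 2 ≤ d) (hT : TriangleCondition d) :
    ∃ C : ℝ, Quant.OneArmRateAtCritical d (fun n => C * (n : ℝ) ^ (-(1 / 2 : ℝ))) := by
  obtain ⟨C, hC⟩ := oneArmPolyDecayAtCritical_half_of_triangle hd hT
  refine ⟨C, ?_, fun n hn => hC n hn⟩
  have h := ((tendsto_rpow_neg_atTop (by norm_num : (0 : ℝ) < 1 / 2)).comp
    tendsto_natCast_atTop_atTop).const_mul C
  rw [mul_zero] at h
  exact h

/-! ### `d ≥ 11`: the same rows, conditional on Fitzner–van der Hofstad's infrared bound (named fact) -/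

/-- **`d ≥ 11` (CONDITIONAL on the named fact `FitznerVanDerHofstad2017_infraredBound`, Fitzner–van der Hofstad 2017
Thm. 1.1, whose computer-assisted lace-expansion proof is not formalised):** the (T2) row with the sharp exponent `1` and the
(T1) row with exponent `1/2`, for every `d ≥ 11` (the infrared bound gives the triangle condition:
`FitznerVanDerHofstad2017_triangleCondition_of_infraredBound`).  Bookkeeping; the gate records the named-fact hypothesis.
[cite: FitznerVanDerHofstad2017, Thm. 1.1 and Cor. 1.3] -/
theorem highDimRows_of_infraredBound (hIR : FitznerVanDerHofstad2017_infraredBound) (hd : 11 ≤ d) :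
    (∃ C : ℝ, 0 < C ∧ Quant.ThetaHolderNearCritical d 1 C) ∧
      (∃ C : ℝ, Quant.OneArmPolyDecayAtCritical d (1 / 2) C) :=
  have hT : TriangleCondition d := FitznerVanDerHofstad2017_triangleCondition_of_infraredBound hIR d hd
  ⟨thetaHolderNearCritical_one_of_triangle (by omega) hT, oneArmPolyDecayAtCritical_half_of_triangle (by omega) hT⟩

/-! ### `d > 6`, two-point bounded ratio: the SHARP one-arm exponent `2`, conditional on Kozma–Nachmias Thm. 2 -/

/-- **(T1) with the sharp exponent `2` (CONDITIONAL on the named fact `KozmaNachmias2011_thm2`):** for `d > 6` under the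
two-point bounded-ratio hypothesis `TwoPointBoundedRatio d` (`τ_{p_c}(x,y) ≍ |x−y|^{2−d}`, Hara 2008 for `d ≥ 11` — itself a
named fact in the tree), `∃ C, OneArmPolyDecayAtCritical d 2 C`, i.e. `π_{p_c}(n) ≤ C n^{−2}` — Kozma–Nachmias 2011 Thm. 1,
through the tree's `KozmaNachmias2011_oneArmUpper_of_thm2` (Lemma 2.3 and Thm. 1 ⇐ Thm. 2 proved there; Thm. 2 vendored) and
`AizenmanNewman1984_gamma_eq_one_holds`.  Bookkeeping; for comparison, the lane's transfers turn this sharp (T1) into (T2)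
exponents `4/(d+2)` (R4.b) and `4/d` (volume route) only, while the sharp (T2) exponent `1` comes from `δ = 2`
(`thetaHolderNearCritical_one_of_triangle`).
[cite: KozmaNachmias2011, Thm. 1 (conditional version, §1.1) and Thm. 2] [cite: HeydenreichVanDerHofstad2017, Thm. 11.5 (11.3.2)] -/
theorem oneArmPolyDecayAtCritical_two_of_kozmaNachmias (hKN : KozmaNachmias2011_thm2) (hd : 6 < d)
    (hτ : TwoPointBoundedRatio d) : ∃ C : ℝ, Quant.OneArmPolyDecayAtCritical d 2 C := by
  obtain ⟨C, hC⟩ := KozmaNachmias2011_oneArmUpper_of_thm2 AizenmanNewman1984_gamma_eq_one_holds hKN d hd hτ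
  refine ⟨C, fun n hn => ?_⟩
  have hn0 : (0 : ℝ) < n := by exact_mod_cast hn
  calc (bondPercolation (zdGraph d) (criticalProbI d)).real (siteToBoundary d n)
      = oneArmProb d (criticalProbI d) n := rfl
    _ ≤ C / (n : ℝ) ^ 2 := hC n hn
    _ = C * (n : ℝ) ^ (-(2 : ℝ)) := by rw [Real.rpow_neg hn0.le, Real.rpow_two, div_eq_mul_inv]

end Summit.CriticalPhenomena.PercolationContinuityZ3.Theorems.Quant
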